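import Summits.ABC.StewartYu.PadicG3TwoSizes
import Summits.ABC.StewartYu.PadicG3TwoLevelZeroAll
import Summits.ABC.StewartYu.PadicG3TwoScheduleEnd
import Summits.ABC.StewartYu.PadicG3TwoRecordL1
import Summits.ABC.StewartYu.PadicG3ParF
import Literature.NumberTheory.Transcendental.PiTranscendenceMeasureMain
import HarnessLib

/-!
# Cell abc-stewartyu, Gen-3 frame at `p = 2` (crux `Y07Two`, stmt-ABC-19659), record: SCHEDULE ARITHMETIC of the
# schedule of record `schedTwoS` in the letters of the parameter ledger `PadicG3Par`

`Summits/ABC/StewartYu/PadicG3TwoScheduleArith.lean` — cell `abc-stewartyu` (HOME `run/shared/lean/pub/abc-stewartyu/`),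
route `PadicPrimesKummerThird`, seat p3 (g6, F-two lead).  Theorems only (real arithmetic), the inputs of the k-step /
third-step budget lines (L2₀)/(L2)/(L3): depth `3^{I*} < 3·2^{n+24+m}`, `I*·log 3 ≤ log 3 + (n+24+m)·log 2`; start
order `T03 0 ≤ (8n+19)·L`, `T03 I ≤ T03 0`; ranges `Xs3 I < 3^I·X`, `Xs3 0 ≤ X`, `(31/33)·X ≤ Xs3 0`; zeros per
sub-step `(247/72)·X·L ≤ Xs3 I·T3 I` (`T3 I ≥ 8`); boxes `Dbox3 0 j ≤ L/2 + 1`, `2·Dbox3 0 j + 1 ≤ 2L`,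
`log #box ≤ lunk`; far-height units `hbox0 ≤ n·L`, `hboxR I ≤ 2n·L/3^I` (`I ≥ 1`) under the datum links
`h(αⱼ) ≤ Aⱼ`, `h(θ) ≤ A_θ`; directional slot `log Xb3R I ≤ W_L − 1 + log 2n` under `|bⱼ|, |b_θ| ≤ e^W`.

WHAT THIS IS NOT: the budget comparisons themselves (sequel `PadicG3TwoBudgetK`); no crux moves.

References: Yu. V. Nesterenko, LNM 1819 (2003), §4 (4.3)–(4.5), §4.2 (4.26), §4.3 (4.35); K. Yu, Acta Math. 211
(2013), §3.1, Lemma 5.2.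
-/
noncomputable section

open Finset Real
open Literature.NumberTheory.Transcendental
open Literature.NumberTheory.Transcendental.CW77.Setup (Tau tauNorm)

namespace Summit.ABC.StewartYu

namespace TwoSetup

open Summit.ABC.StewartYu.G3Boxes Summit.ABC.StewartYu.PadicG3Par

variable (S : TwoSetup) (P : PadicG3Par (S.d + 1))

/-! ### Schedule arithmetic in the letters of `P` -/

/-- **Depth in logs**: `I*·log 3 ≤ log 3 + (n+24+m)·log 2`. [folklore] -/
theorem Istar3_mul_log_three_le :
    (S.Istar3 P : ℝ) * Real.log 3 ≤ Real.log 3 + ((S.d : ℝ) + 1 + 24 + P.m) * Real.log 2 := by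
  have h := S.three_pow_Istar3_lt P
  have h' : ((3 : ℕ) : ℝ) ^ S.Istar3 P < 3 * ((2 : ℕ) : ℝ) ^ (S.d + 1 + 24 + P.m) := by exact_mod_cast h
  have hlog := Real.log_lt_log (by positivity) h'
  rw [Real.log_pow, Real.log_mul (by norm_num) (by positivity), Real.log_pow] at hlog
  push_cast at hlog
  exact hlog.le

/-- **Start order**: `T03 0 ≤ (8n+19)·L` (`M/(n+2)³ ≤ 2L`, `T3 0 = 4L`, `L ≥ 1`). [folklore] -/
theorem T03_zero_le : (S.T03 P 0 : ℝ) ≤ (8 * ((S.d : ℝ) + 1) + 19) * P.L := by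
  have hL : 1 ≤ P.L := by have := P.two_pow_le_L; have : 1 ≤ 2 ^ (S.d + 1 + 24) := Nat.one_le_two_pow; omega
  have hM : P.M / (S.d + 1 + 2) ^ 3 ≤ 2 * P.L := by
    rw [P.M_eq]
    calc 16 * (S.d + 1 + 1) * P.L / (S.d + 1 + 2) ^ 3 ≤ 2 * (S.d + 1 + 2) ^ 3 * P.L / (S.d + 1 + 2) ^ 3 := by
          apply Nat.div_le_div_right
          have h9 : 9 ≤ (S.d + 1 + 2) ^ 2 := by
            have := Nat.pow_le_pow_left (show 3 ≤ S.d + 1 + 2 by omega) 2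
            simpa using this
          have : 16 * (S.d + 1 + 1) ≤ 2 * (S.d + 1 + 2) ^ 3 := by
            calc 16 * (S.d + 1 + 1) ≤ 2 * (9 * (S.d + 1 + 2)) := by omega
              _ ≤ 2 * ((S.d + 1 + 2) ^ 2 * (S.d + 1 + 2)) := by
                  exact Nat.mul_le_mul_left _ (Nat.mul_le_mul_right _ h9)
              _ = 2 * (S.d + 1 + 2) ^ 3 := by ring
          exact Nat.mul_le_mul_right _ this
      _ = 2 * P.L := by
          rw [mul_assoc, mul_comm ((S.d+1+2)^3) P.L, ← mul_assoc, Nat.mul_div_cancel _ (by positivity)]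
  have hT : S.T3 P 0 = 4 * P.L := by unfold T3; simp
  have h : S.T03 P 0 ≤ (8 * (S.d + 1) + 19) * P.L := by
    unfold T03; rw [hT]; nlinarith
  have h' : ((S.T03 P 0 : ℕ) : ℝ) ≤ (((8 * (S.d + 1) + 19) * P.L : ℕ) : ℝ) := by exact_mod_cast h
  push_cast at h'
  linarith

/-- `T03` is antitone in the level. [folklore] -/
theorem T03_le_T03_zero (I : ℕ) : S.T03 P I ≤ S.T03 P 0 := by
  unfold T03 T3
  have : 4 * P.L / 3 ^ I ≤ 4 * P.L / 3 ^ 0 := Nat.div_le_div_left (Nat.one_le_pow _ _ (by norm_num)) (by norm_num)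
  nlinarith

/-- `T3 I ≤ 4L ≤ 8L`. [folklore] -/
theorem T3_le (I : ℕ) : S.T3 P I ≤ 8 * P.L := by
  unfold T3; exact (Nat.div_le_self _ _).trans (by omega)

/-- **Ranges**: `Xs3 I < 3^I·X` (real; `3^I·(T3 I + 1) > 4L`). [folklore] -/
theorem Xs3_lt (I : ℕ) : (S.Xs3 P I : ℝ) < (3 : ℝ) ^ I * P.X := by
  have hL : (0 : ℝ) < P.L := by linarith [P.one_le_L]
  have hX : (0 : ℝ) < P.X := by linarith [P.seventytwo_le_X]
  have ht : (4 * P.L : ℝ) < 3 ^ I * ((S.T3 P I : ℝ) + 1) := by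
    have h := Nat.lt_div_mul_add (a := 4 * P.L) (b := 3 ^ I) (by positivity)
    unfold T3
    have : ((4 * P.L : ℕ) : ℝ) < ((4 * P.L / 3 ^ I * 3 ^ I + 3 ^ I : ℕ) : ℝ) := by exact_mod_cast h
    push_cast at this
    linarith
  have hXs : (S.Xs3 P I : ℝ) * ((S.T3 P I : ℝ) + 1) ≤ 4 * P.X * P.L := by
    have := (P.schedule_of_le (S.T3_le P I)).2.1
    unfold Xs3; exact this
  have hpos : (0 : ℝ) < (S.T3 P I : ℝ) + 1 := by positivity
  by_contra hc
  push Not at hc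
  have : (3 : ℝ) ^ I * P.X * ((S.T3 P I : ℝ) + 1) ≤ (S.Xs3 P I : ℝ) * ((S.T3 P I : ℝ) + 1) :=
    mul_le_mul_of_nonneg_right hc hpos.le
  nlinarith

/-- `Xs3 0 ≤ X`. [folklore] -/
theorem Xs3_zero_le : (S.Xs3 P 0 : ℝ) ≤ P.X := by
  have := S.Xs3_lt P 0; rw [pow_zero, one_mul] at this; exact this.le

/-- `(31/33)·X ≤ Xs3 0` (`Xs3 0·(4L+1) ≥ (31/8)·X·L` and `4L + 1 ≤ (33/8)·L`). [folklore] -/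
theorem Xs3_zero_ge : (31 / 33 : ℝ) * P.X ≤ S.Xs3 P 0 := by
  have hL : (2 : ℝ) ^ 25 ≤ P.L := P.two_pow_25_le_L
  have hX : (0 : ℝ) ≤ P.X := by positivity
  have hT : S.T3 P 0 = 4 * P.L := by unfold T3; simp
  have h := (P.schedule_of_le (S.T3_le P 0)).1
  have hXs : (31 / 8 : ℝ) * P.X * P.L ≤ (S.Xs3 P 0 : ℝ) * ((S.T3 P 0 : ℝ) + 1) := by unfold Xs3; exact h
  rw [hT] at hXs
  push_cast at hXs
  have hXs0 : (0 : ℝ) ≤ (S.Xs3 P 0 : ℝ) := by positivity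
  -- `Xs3 0 · (33/8) L ≥ Xs3 0 · (4L + 1) ≥ (31/8) X L`
  have h1 : (S.Xs3 P 0 : ℝ) * (4 * (P.L : ℝ) + 1) ≤ (S.Xs3 P 0 : ℝ) * ((33 / 8) * P.L) :=
    mul_le_mul_of_nonneg_left (by linarith [show (8:ℝ) ≤ 2^25 by norm_num]) hXs0
  have hLpos : (0 : ℝ) < P.L := by linarith [show (0:ℝ) < 2^25 by norm_num]
  nlinarith

/-- **Zeros per sub-step**: `(247/72)·X·L ≤ Xs3 I · T3 I` when `T3 I ≥ 8`. [cite: Nesterenko2003, (4.3); shape only] -/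
theorem Xs3_mul_T3_ge (I : ℕ) (hT : 8 ≤ S.T3 P I) :
    (247 / 72 : ℝ) * P.X * P.L ≤ (S.Xs3 P I : ℝ) * (S.T3 P I : ℝ) := by
  have h := P.schedule_of_le (S.T3_le P I)
  have hlo : (31 / 8 : ℝ) * P.X * P.L ≤ (S.Xs3 P I : ℝ) * ((S.T3 P I : ℝ) + 1) := by unfold Xs3; exact h.1
  have hhi : (S.Xs3 P I : ℝ) * ((S.T3 P I : ℝ) + 1) ≤ 4 * P.X * P.L := by unfold Xs3; exact h.2.1
  have hT' : (9 : ℝ) ≤ (S.T3 P I : ℝ) + 1 := by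
    have : (8 : ℝ) ≤ (S.T3 P I : ℝ) := by exact_mod_cast hT
    linarith
  have hXs0 : (0 : ℝ) ≤ (S.Xs3 P I : ℝ) := by positivity
  -- `Xs ≤ 4XL/9`
  have hXs : (S.Xs3 P I : ℝ) ≤ 4 * P.X * P.L / 9 := by
    rw [le_div_iff₀ (by norm_num)]
    nlinarith
  nlinarith

/-! ### Boxes and far heights -/

/-- `A j ≥ 1 ⇒ side j ≤ L/2`, hence `Dbox3 0 j ≤ L/2 + 1`. [folklore] -/
theorem Dbox3_zero_le_half (hA1 : ∀ j, 1 ≤ P.A j) (j : Fin S.d) : (S.Dbox3 P 0 j : ℝ) ≤ P.L / 2 + 1 := by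
  rw [S.Dbox3_zero P j]
  have hs := P.side_le (Fin.castSucc j)
  have hA := hA1 (Fin.castSucc j)
  have hL : (1 : ℝ) ≤ P.L := P.one_le_L
  have h2 : (P.side (Fin.castSucc j) : ℝ) ≤ P.L / 2 := by
    refine hs.trans ?_
    rw [div_le_div_iff₀ (by linarith) (by norm_num)]
    nlinarith
  push_cast
  linarith

/-- The same for the `θ`-box: `Dθ3 0 ≤ L/2 + 1`. [folklore] -/
theorem Dθ3_zero_le_half (hA1 : ∀ j, 1 ≤ P.A j) : (S.Dθ3 P 0 : ℝ) ≤ P.L / 2 + 1 := by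
  rw [S.Dθ3_zero P]
  have hs := P.side_le (Fin.last S.d)
  have hA := hA1 (Fin.last S.d)
  have hL : (1 : ℝ) ≤ P.L := P.one_le_L
  have h2 : (P.side (Fin.last S.d) : ℝ) ≤ P.L / 2 := by
    refine hs.trans ?_
    rw [div_le_div_iff₀ (by linarith) (by norm_num)]
    nlinarith
  push_cast
  linarith

/-- `A j ≥ 1 ⇒ side j ≤ L/2`, hence `2·Dbox3 0 j + 1 ≤ 2L` and the same for `θ`. [folklore] -/
theorem two_mul_Dbox3_zero_add_one_le (hA1 : ∀ j, 1 ≤ P.A j) (j : Fin S.d) :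
    ((2 * S.Dbox3 P 0 j + 1 : ℕ) : ℝ) ≤ 2 * P.L := by
  rw [S.Dbox3_zero P j]
  have hs := P.side_le (Fin.castSucc j)
  have hA := hA1 (Fin.castSucc j)
  have hL : (1 : ℝ) ≤ P.L := P.one_le_L
  have h2 : (P.side (Fin.castSucc j) : ℝ) ≤ P.L / 2 := by
    refine hs.trans ?_
    rw [div_le_div_iff₀ (by linarith) (by norm_num)]
    nlinarith
  have hL3 : (3 : ℝ) ≤ P.L := by have := P.two_pow_25_le_L; linarith [show (3:ℝ) ≤ 2^25 by norm_num]
  push_cast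
  linarith

/-- The same for the `θ`-box. [folklore] -/
theorem two_mul_Dθ3_zero_add_one_le (hA1 : ∀ j, 1 ≤ P.A j) :
    ((2 * S.Dθ3 P 0 + 1 : ℕ) : ℝ) ≤ 2 * P.L := by
  rw [S.Dθ3_zero P]
  have hs := P.side_le (Fin.last S.d)
  have hA := hA1 (Fin.last S.d)
  have hL : (1 : ℝ) ≤ P.L := P.one_le_L
  have h2 : (P.side (Fin.last S.d) : ℝ) ≤ P.L / 2 := by
    refine hs.trans ?_
    rw [div_le_div_iff₀ (by linarith) (by norm_num)]
    nlinarith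
  have hL3 : (3 : ℝ) ≤ P.L := by have := P.two_pow_25_le_L; linarith [show (3:ℝ) ≤ 2^25 by norm_num]
  push_cast
  linarith

/-- **`log #box ≤ lunk`** (`= log(L₀+1) + n·log 2L`). [folklore] -/
theorem log_cardB_le_lunk (hA1 : ∀ j, 1 ≤ P.A j) (I : ℕ) :
    Real.log ((S.schedTwoS P).cardB I : ℝ) ≤ P.lunk := by
  rw [S.log_cardB_schedTwoS P I]
  unfold PadicG3Par.lunk
  have hL : (1 : ℝ) ≤ P.L := P.one_le_L
  have h1 : ∀ j, Real.log ((2 * S.Dbox3 P 0 j + 1 : ℕ) : ℝ) ≤ Real.log (2 * P.L) := fun j =>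
    Real.log_le_log (by positivity) (S.two_mul_Dbox3_zero_add_one_le P hA1 j)
  have h2 : Real.log ((2 * S.Dθ3 P 0 + 1 : ℕ) : ℝ) ≤ Real.log (2 * P.L) :=
    Real.log_le_log (by positivity) (S.two_mul_Dθ3_zero_add_one_le P hA1)
  have hsum : ∑ j : Fin S.d, Real.log ((2 * S.Dbox3 P 0 j + 1 : ℕ) : ℝ) ≤ S.d * Real.log (2 * P.L) := by
    calc ∑ j : Fin S.d, Real.log ((2 * S.Dbox3 P 0 j + 1 : ℕ) : ℝ) ≤ ∑ _j : Fin S.d, Real.log (2 * P.L) :=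
          Finset.sum_le_sum fun j _ => h1 j
      _ = S.d * Real.log (2 * P.L) := by simp
  have e1 : (((P.L₀ + 1 : ℕ)) : ℝ) = (P.L₀ : ℝ) + 1 := by push_cast; ring
  have e2 : (((S.d + 1 : ℕ)) : ℝ) = (S.d : ℝ) + 1 := by push_cast; ring
  rw [e1, e2]
  linarith

/-- **Level-`0` far-height unit**: `hbox0 ≤ n·L` under the datum links `h(αⱼ) ≤ Aⱼ`, `h(θ) ≤ A_θ`
(`(side j + 1)·Aⱼ ≤ L/2 + Aⱼ`, `2·Amax ≤ L`). [cite: Nesterenko2003, §4.2 (4.26); shape only] -/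
theorem hbox0_le (hα : ∀ j, Height.logHeight₁ (S.α j) ≤ P.A (Fin.castSucc j))
    (hθ : Height.logHeight₁ S.θ ≤ P.A (Fin.last S.d)) :
    S.hbox0 P ≤ ((S.d : ℝ) + 1) * P.L := by
  unfold hbox0
  have hL : (1 : ℝ) ≤ P.L := P.one_le_L
  have hAm := P.two_Amax_le_L
  have key : ∀ j : Fin (S.d + 1), ((P.side j : ℝ) + 1) * P.A j ≤ P.L := by
    intro j
    have hs := P.side_le j
    have hA := P.A_pos j
    have hAmax := P.hAmax j
    have h1 : (P.side j : ℝ) * (2 * P.A j) ≤ P.L := (le_div_iff₀ (by positivity)).mp hs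
    nlinarith
  have h1 : ∀ j : Fin S.d, (S.Dbox3 P 0 j : ℝ) * Height.logHeight₁ (S.α j) ≤ P.L := by
    intro j
    rw [S.Dbox3_zero P j]
    have h0 : 0 ≤ Height.logHeight₁ (S.α j) := Height.zero_le_logHeight₁ _
    calc ((P.side (Fin.castSucc j) + 1 : ℕ) : ℝ) * Height.logHeight₁ (S.α j)
        ≤ ((P.side (Fin.castSucc j) + 1 : ℕ) : ℝ) * P.A (Fin.castSucc j) :=
          mul_le_mul_of_nonneg_left (hα j) (by positivity)
      _ ≤ P.L := by push_cast; exact key _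
  have h2 : (S.Dθ3 P 0 : ℝ) * Height.logHeight₁ S.θ ≤ P.L := by
    rw [S.Dθ3_zero P]
    calc ((P.side (Fin.last S.d) + 1 : ℕ) : ℝ) * Height.logHeight₁ S.θ
        ≤ ((P.side (Fin.last S.d) + 1 : ℕ) : ℝ) * P.A (Fin.last S.d) :=
          mul_le_mul_of_nonneg_left hθ (by positivity)
      _ ≤ P.L := by push_cast; exact key _
  calc ∑ j : Fin S.d, (S.Dbox3 P 0 j : ℝ) * Height.logHeight₁ (S.α j) + (S.Dθ3 P 0 : ℝ) * Height.logHeight₁ S.θ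
      ≤ ∑ _j : Fin S.d, (P.L : ℝ) + P.L := add_le_add (Finset.sum_le_sum fun j _ => h1 j) h2
    _ = ((S.d : ℝ) + 1) * P.L := by simp; ring

/-- **Far-height unit at level `I ≥ 1`**: `hboxR I ≤ 2n·L/3^I` (`Dbox3R I j·Aⱼ ≤ (L + 2Aⱼ)/3^I ≤ 2L/3^I`).
[cite: Nesterenko2003, §4.3 (4.35); shape only] -/
theorem hboxR_le_L {I : ℕ} (hI : 1 ≤ I) (hα : ∀ j, Height.logHeight₁ (S.α j) ≤ P.A (Fin.castSucc j))
    (hθ : Height.logHeight₁ S.θ ≤ P.A (Fin.last S.d)) :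
    S.hboxR P I ≤ 2 * ((S.d : ℝ) + 1) * P.L / (3 : ℝ) ^ I := by
  unfold hboxR
  have hL : (1 : ℝ) ≤ P.L := P.one_le_L
  have hAm := P.two_Amax_le_L
  have h3 : (0 : ℝ) < (3 : ℝ) ^ I := by positivity
  obtain ⟨I', rfl⟩ : ∃ I', I = I' + 1 := ⟨I - 1, by omega⟩
  -- the real bound of the level-`I` boxes
  have key : ∀ j : Fin (S.d + 1), ((2 * (P.side j + 1) / 3 ^ (I' + 1) : ℕ) : ℝ) * P.A j ≤ 2 * P.L / (3 : ℝ) ^ (I' + 1) := by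
    intro j
    have hs := P.side_le j
    have hA := P.A_pos j
    have hAmax := P.hAmax j
    have hdiv : ((2 * (P.side j + 1) / 3 ^ (I' + 1) : ℕ) : ℝ) ≤ (2 * ((P.side j : ℝ) + 1)) / (3 : ℝ) ^ (I' + 1) := by
      have := Nat.cast_div_le (m := 2 * (P.side j + 1)) (n := 3 ^ (I' + 1)) (α := ℝ)
      push_cast at this ⊢; exact this
    have hnum : 2 * ((P.side j : ℝ) + 1) * P.A j ≤ 2 * P.L := by
      have h1 : (P.side j : ℝ) * (2 * P.A j) ≤ P.L := (le_div_iff₀ (by positivity)).mp hs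
      nlinarith
    calc ((2 * (P.side j + 1) / 3 ^ (I' + 1) : ℕ) : ℝ) * P.A j
        ≤ (2 * ((P.side j : ℝ) + 1)) / (3 : ℝ) ^ (I' + 1) * P.A j := mul_le_mul_of_nonneg_right hdiv hA.le
      _ = (2 * ((P.side j : ℝ) + 1) * P.A j) / (3 : ℝ) ^ (I' + 1) := by ring
      _ ≤ 2 * P.L / (3 : ℝ) ^ (I' + 1) := div_le_div_of_nonneg_right hnum h3.le
  have h1 : ∀ j : Fin S.d, (S.Dbox3R P (I' + 1) j : ℝ) * Height.logHeight₁ (S.α j) ≤ 2 * P.L / (3 : ℝ) ^ (I' + 1) := by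
    intro j
    rw [S.Dbox3R_succ P I' j, S.Dbox3_zero P j]
    have h0 : 0 ≤ Height.logHeight₁ (S.α j) := Height.zero_le_logHeight₁ _
    calc ((2 * (P.side (Fin.castSucc j) + 1) / 3 ^ (I' + 1) : ℕ) : ℝ) * Height.logHeight₁ (S.α j)
        ≤ ((2 * (P.side (Fin.castSucc j) + 1) / 3 ^ (I' + 1) : ℕ) : ℝ) * P.A (Fin.castSucc j) :=
          mul_le_mul_of_nonneg_left (hα j) (by positivity)
      _ ≤ 2 * P.L / (3 : ℝ) ^ (I' + 1) := key _
  have h2 : (S.Dθ3R P (I' + 1) : ℝ) * Height.logHeight₁ S.θ ≤ 2 * P.L / (3 : ℝ) ^ (I' + 1) := by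
    rw [S.Dθ3R_succ P I', S.Dθ3_zero P]
    calc ((2 * (P.side (Fin.last S.d) + 1) / 3 ^ (I' + 1) : ℕ) : ℝ) * Height.logHeight₁ S.θ
        ≤ ((2 * (P.side (Fin.last S.d) + 1) / 3 ^ (I' + 1) : ℕ) : ℝ) * P.A (Fin.last S.d) :=
          mul_le_mul_of_nonneg_left hθ (by positivity)
      _ ≤ 2 * P.L / (3 : ℝ) ^ (I' + 1) := key _
  calc ∑ j : Fin S.d, (S.Dbox3R P (I' + 1) j : ℝ) * Height.logHeight₁ (S.α j) +
        (S.Dθ3R P (I' + 1) : ℝ) * Height.logHeight₁ S.θ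
      ≤ ∑ _j : Fin S.d, 2 * (P.L : ℝ) / (3 : ℝ) ^ (I' + 1) + 2 * P.L / (3 : ℝ) ^ (I' + 1) :=
        add_le_add (Finset.sum_le_sum fun j _ => h1 j) h2
    _ = 2 * ((S.d : ℝ) + 1) * P.L / (3 : ℝ) ^ (I' + 1) := by simp; ring

/-- **Directional slot**: `log Xb3R I ≤ W_L − 1 + log 2n` under `|bⱼ|, |b_θ| ≤ e^W`
(`Xb3R I ≤ 1 + 2d·e^W·(L+2) ≤ 2n·e^W·2L`). [folklore] -/
theorem log_Xb3R_le (I : ℕ) (hA1 : ∀ j, 1 ≤ P.A j) (hb : ∀ j, (|S.b j| : ℝ) ≤ Real.exp P.W)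
    (hbθ : (|S.bθ| : ℝ) ≤ Real.exp P.W) :
    Real.log (S.Xb3R P I : ℝ) ≤ P.WL - 1 + Real.log (2 * ((S.d : ℝ) + 1)) := by
  have hL : (1 : ℝ) ≤ P.L := P.one_le_L
  have hW1 := P.hW
  have heW : (1 : ℝ) ≤ Real.exp P.W := Real.one_le_exp (by linarith)
  -- every box entry is `≤ L + 2`
  have hDbox : ∀ j, (S.Dbox3R P I j : ℝ) ≤ P.L + 2 := by
    intro j
    have h0 : (S.Dbox3R P I j : ℝ) ≤ 2 * (S.Dbox3 P 0 j : ℝ) := by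
      rcases Nat.eq_zero_or_pos I with h | h
      · subst h
        rw [S.Dbox3R_zero P]
        have h' : (0:ℝ) ≤ S.Dbox3 P 0 j := by positivity
        linarith
      · obtain ⟨I', rfl⟩ : ∃ I', I = I' + 1 := ⟨I - 1, by omega⟩
        rw [S.Dbox3R_succ P I' j]
        exact_mod_cast Nat.div_le_self _ _
    have h1 := S.Dbox3_zero_le_half P hA1 j
    linarith
  have hDθ : (S.Dθ3R P I : ℝ) ≤ P.L + 2 := by
    have h0 : (S.Dθ3R P I : ℝ) ≤ 2 * (S.Dθ3 P 0 : ℝ) := by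
      rcases Nat.eq_zero_or_pos I with h | h
      · subst h
        rw [S.Dθ3R_zero P]
        have h' : (0:ℝ) ≤ S.Dθ3 P 0 := by positivity
        linarith
      · obtain ⟨I', rfl⟩ : ∃ I', I = I' + 1 := ⟨I - 1, by omega⟩
        rw [S.Dθ3R_succ P I']
        exact_mod_cast Nat.div_le_self _ _
    have h1 := S.Dθ3_zero_le_half P hA1
    linarith
  have hXb : (S.Xb3R P I : ℝ) ≤ (2 * ((S.d : ℝ) + 1)) * (Real.exp P.W * (P.L + 2)) := by
    unfold Xb3R
    push_cast
    have hs1 : |(S.bθ : ℝ)| * ∑ j : Fin S.d, (S.Dbox3R P I j : ℝ) ≤ Real.exp P.W * (S.d * (P.L + 2)) := by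
      have hsum : ∑ j : Fin S.d, (S.Dbox3R P I j : ℝ) ≤ S.d * (P.L + 2) := by
        calc ∑ j : Fin S.d, (S.Dbox3R P I j : ℝ) ≤ ∑ _j : Fin S.d, ((P.L : ℝ) + 2) :=
              Finset.sum_le_sum fun j _ => hDbox j
          _ = S.d * (P.L + 2) := by simp only [Finset.sum_const, Finset.card_univ, Fintype.card_fin, nsmul_eq_mul]
      exact mul_le_mul hbθ hsum (by positivity) (by positivity)
    have hs2 : (∑ j : Fin S.d, |(S.b j : ℝ)|) * (S.Dθ3R P I : ℝ) ≤ (S.d * Real.exp P.W) * (P.L + 2) := by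
      have hsum : ∑ j : Fin S.d, |(S.b j : ℝ)| ≤ S.d * Real.exp P.W := by
        calc ∑ j : Fin S.d, |(S.b j : ℝ)| ≤ ∑ _j : Fin S.d, Real.exp P.W :=
              Finset.sum_le_sum fun j _ => hb j
          _ = S.d * Real.exp P.W := by simp only [Finset.sum_const, Finset.card_univ, Fintype.card_fin, nsmul_eq_mul]
      exact mul_le_mul hsum hDθ (by positivity) (by positivity)
    have hd0 : (0 : ℝ) ≤ S.d := by positivity
    nlinarith [hs1, hs2, heW, hL]
  have hpos : (0 : ℝ) < (S.Xb3R P I : ℝ) := by have := S.one_le_Xb3R P I; exact_mod_cast (by omega : (0:ℤ) < S.Xb3R P I)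
  have hlog := Real.log_le_log hpos hXb
  have hWL := P.W_add_log_le_WL
  have hL2 : (P.L : ℝ) + 2 ≤ 2 * P.L := by have := P.two_pow_25_le_L; linarith [show (2:ℝ) ≤ 2^25 by norm_num]
  have e0 : Real.log (Real.exp P.W * ((P.L : ℝ) + 2)) = P.W + Real.log (P.L + 2) := by
    rw [Real.log_mul (Real.exp_pos _).ne' (by positivity), Real.log_exp]
  have e1 : Real.log ((2 * ((S.d : ℝ) + 1)) * (Real.exp P.W * (P.L + 2))) =
      Real.log (2 * ((S.d : ℝ) + 1)) + (P.W + Real.log (P.L + 2)) := by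
    rw [Real.log_mul (by positivity) (by positivity), e0]
  have hlogL : Real.log ((P.L : ℝ) + 2) ≤ Real.log (2 * P.L) := Real.log_le_log (by positivity) hL2
  linarith

end TwoSetup

end Summit.ABC.StewartYu

end
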